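/-
Copyright (c) 2026 the pub-hodgecm-mathlib formalisation cell (harness21).  Prover seat hodgecm-mathlib-LH4-p15 (g3), req620 Track A «(D-RAM) FOUR-FRAME» squad
((β₂) road (R-36), the K6 road — K6 DESK WORD #17 A2 «THE INSIDE CELLS' LAW ON `Rd⋆`»: ★ F1b p864627 on EVERY inside cell of the live even row, its class, floor and
precision letters DISCHARGED from the CORE frame and the K6 floor, carried to ONE fine digit system by ★ A2r `cellLaw_fine_of_coarse`), 2026-09-05.
-/
import Summits.HodgeConjecture.HodgeConjecture.Theorems.F0P3cDyRamRowTowerCellPerCellValue    -- ★ F1b p864627 (LH4-p18 (g4)): `rowTower_cellDiff_mul_card_eq` (★ K6-0 HEAD′ on a row tower cell)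
import Summits.HodgeConjecture.HodgeConjecture.Theorems.F0P3cDyRamCellLawCommonResolution     -- ★ A2r p864770 (LH4-p16 (g3)): `cellLaw_fine_of_coarse` (the law moves to any finer digit system)
import Summits.HodgeConjecture.HodgeConjecture.Theorems.F0P3cDyRamRamKFrameClassLetters        -- ★ p864373 (LH4-p19 (g3)): `fgap_of_datum`, `deep_of_datum`, `dich_of_datum`, `exists_flipWitness_of_frame`
import Summits.HodgeConjecture.HodgeConjecture.Theorems.F0P3cDyRamDiagonalFixedClassSystems     -- ★ (LH4-p08 lineage): `exists_repr_fixedBall_card` (a digit system of the fixed ball at any resolution)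
import HarnessLib

/-!
# Crux `H413`, line LH4 «(D-RAM) FOUR-FRAME» — (β₂) road, the K6 road, A2: «THE INSIDE CELLS' LAW ON ONE FINE DIGIT SYSTEM» — for the general block `(H₂, h_W, φ, h, f)`,
# in ‹CORE.letter.v1›'s frame + the K6 floor `4d ≤ N₀ ≤ m`, with the row's inside chart (★ A1 p864708) and ONE σ-fixed integral digit system `Rd⋆` mod `|ϖ|^{n⋆}`,
# `n⋆ ≥ b + 2(N − 1)`: `∀ i < N, X(b+2i)·#(Rd⋆.filter LIT_i) = n(b+2i)·(ω(−h_W)·Σ_{V ∈ Rd⋆.filter LIT_i} ω(α₁ + γ₁V))`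

Cell `hodgecm-mathlib` (D-0151), FLOOR 0, crux item H413 = `stmt-HodgeConjecture-24833`, route of record `HCCMUnconditional`; squad F0∕P3c∕LH4; lane
`--supports stmt-HodgeConjecture-24833 --as helper` (count-neutral; pays NO tier-0 row).  THEOREMS ONLY (no `def`, no instance, no notation, no `sorry`, default heartbeats);
★-only imports; states NO law; ‹CORE›∕‹CORE-ODD›∕(β₂) stay HYPOTHESES of their consumers.

WHAT (K6 DESK WORD #17, the assembly DAG A1–A6 of `core_holds`).  The live even row `2b = m` (`d` even) with window `jl = m + 2N`, `N ≥ 1`, has the inside cells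
`(j, b) = (b + 2i, b)`, `i < N`.  ★ F1b `…RowTowerCellPerCellValue.rowTower_cellDiff_mul_card_eq` gives, on ONE such cell and ONE digit system `Rd` modulo a radius `r`, the
K6-0 law `X(j,b)·#(Rd.filter LIT) = n(j,b)·(ω(−h_W)·Σ_{(Rd.filter LIT).filter ⊤} ω(α₁ + γ₁·V))` — behind the frame's CLASS LETTERS (`hFgap hdeep₂ c₀ hc₀1 hdich hwit`), the
FLOOR LETTERS (`hmcm hlamn hun`), the cell letters (`hbj hjm hcell`) and the PRECISION LETTERS (`hrfloor hrR hr₀ hdeep hrγ`).  THIS FILE discharges all of them: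
* the class letters from the frame by ★ p864373 (`fgap_of_datum`, `deep_of_datum` at `2d − 1` and `2d`, `dich_of_datum`, `exists_flipWitness_of_frame`);
* the floor letters from the K6 floor `4d ≤ N₀ ≤ m`, `|u₀₀ − 1| ≤ |ϖ|^{N₀}`, `|lam − 1| ≤ |jEϖ|^{N₀}` (‹CORE.v1›'s `_hNm _hu1N _hlam1` at the assembler's fence; `m_c = 3d − 2 ≤ 4d`);
* the cell and precision letters by exponent arithmetic at the cell's OWN resolution `r_i := |ϖ|^{n_i}`, `n_i := b + 2(N − 1 − i)` and `r₀ := |jEϖ|^{2d−1}`: in the inside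
  chart `|ξ₀| = exp 2(N − 1)` the sharp floor `|jEϖ|^{2b} ≤ r_i·|ξ₀|·|jEϖ|^j` is an EQUALITY, `hrR` is `b ≥ 1`, `hr₀` is `b ≥ 2d − 1`, `hrγ` is `n_i + 2 ≥ 2d − 1` (`|γ₁| = |ϖ|²`),
  all from `b ≥ 2d` (`2b = m ≥ N₀ ≥ 4d`);
so §1 `insideCell_law_coarse` is ★ F1b on the cell `i` for ANY complete irredundant digit system mod `|ϖ|^{n_i}` (e.g. ★ `exists_repr_fixedBall_card (ρ := n_i) (t := 0)`), with
no letter left but the frame, the floor, the row, the chart and the system.  HEAD §2 `insideCells_law_fine` then moves every cell's law to ONE system `Rd⋆` mod `|ϖ|^{n⋆}`,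
`n⋆ ≥ b + 2(N − 1) = max_i n_i`, by ★ A2r `…CellLawCommonResolution.cellLaw_fine_of_coarse` (the literal predicate and the label are class functions mod `r_i`) — the `hmul`
letters of ★ `…CoreOfPerCellLaws.cellValue_of_perCellLaw` for ALL inside cells on the digit set the spine's partition∕density∕`Σ ω = 0` letters live on (A3, A4, ★ (g) p864489).
WHAT IS NOT CLAIMED: the density (A3), the partition and covering (LH4-p11 (P2)), the top cell (A5), any character-sum value, any census identity.
HONEST LABEL.  Count-neutral assembly of ★ pieces; nothing printed is asserted; no census law is stated; `HC_CM` is proved only modulo the 7 printed citations (2 remaining named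
inputs: hLiu418 = `stmt-HodgeConjecture-24832`, h413 = `stmt-HodgeConjecture-24833`) until rung 0 closes.
## References
* [Kottwitz1986BaseChangeUnits] R. E. Kottwitz, *Base change for unit elements of Hecke algebras*, Compositio Math. 60 (1986): §1 pp. 240–241 (signed lattice counts cell by cell).
* [LabesseLanglands1979] J.-P. Labesse, R. P. Langlands, *L-indistinguishability for SL(2)*, Canad. J. Math. 31 (1979): §2 (2.2) p. 9 (κ-signed counts).
* [Rogawski1990] J. D. Rogawski, *Automorphic Representations of Unitary Groups in Three Variables*, Ann. of Math. Stud. 123 (1990): §4.9 Prop. 4.9.1 (b) p. 55.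
* [Serre1979] J.-P. Serre, *Local Fields*, GTM 67 (1979): Ch. IV §2 Prop. 6 (digit systems); Ch. V §3 Prop. 5, Cor. 2–3; Ch. XV §2 (the conductor of the norm-residue sign).
-/

set_option autoImplicit false

noncomputable section

namespace Summit.HodgeConjecture.HodgeConjecture.Cruxes.H413.F0P3cDyRamInsideCellsLawFine

open scoped Valued WithZero Matrix MatrixGroups Classical
open WithZero Finset
open Literature.NumberTheory.Automorphic Literature.NumberTheory.Automorphic.HermitianLattice Literature.NumberTheory.Automorphic.UnitaryLatticeTree
open Literature.NumberTheory.Automorphic.UnitaryThreeFourFrame (IsRamifiedQuadraticDatum normSign)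
open Literature.NumberTheory.Rogawski1990
open Summit.HodgeConjecture.HodgeConjecture.Cruxes.H413.F0P3cDyRamFourFramePieces
open Summit.HodgeConjecture.HodgeConjecture.Cruxes.H413.F0P3cDyRamFourFrameCensusDefs (LatticeInLevel LatticeNearTransvShell)
open Summit.HodgeConjecture.HodgeConjecture.Cruxes.H413.F0P3cDyRamStageOneBDefs (mcOfRecord)
open Summit.HodgeConjecture.HodgeConjecture.Cruxes.H413.F0P3cDyRamToricCensusDefs
open Summit.HodgeConjecture.HodgeConjecture.Cruxes.H413.F0P3cDyRamRowCellOnShell (uniformizer_letters)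
open Summit.HodgeConjecture.HodgeConjecture.Cruxes.H413.F0P3cDyRamRowTowerCellPerCellValue (rowTower_cellDiff_mul_card_eq)
open Summit.HodgeConjecture.HodgeConjecture.Cruxes.H413.F0P3cDyRamCellLawCommonResolution (cellLaw_fine_of_coarse)
open Summit.HodgeConjecture.HodgeConjecture.Cruxes.H413.F0P3cDyRamRamKFrameClassLetters (fgap_of_datum deep_of_datum dich_of_datum exists_flipWitness_of_frame)
open Summit.HodgeConjecture.HodgeConjecture.Cruxes.H413.F0P3cDyRamDiagonalFixedClassSystems (exists_repr_fixedBall_card)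

variable {E M : Type} [Field E] [Valued E ℤᵐ⁰] [Field M] [Valued M ℤᵐ⁰]

/-! ## §0 The precision letters of an inside cell in the inside chart are exponent arithmetic -/

/-- **THE PRECISION LETTERS OF THE INSIDE CELL `(b + 2i, b)`, `i < N`, AT ITS OWN RESOLUTION `r_i := |ϖ|^{b + 2(N−1−i)}`.**  In the inside chart
(`|ξ₀|·|jEϖ|^jl = |jEϖ|^(m+2)`, i.e. `|ξ₀| = exp 2(N − 1)` for `jl = m + 2N`) of the even row `2b = m` with `2d ≤ b`, and `|γ₁| = |ϖ|²`: the sharp floor is an EQUALITY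
`r_i·|ξ₀|·|jEϖ^{b+2i}(α − ρα)| = |jEϖ|^{2b}`, hence `hrR` (`2b > b`), `hr₀` at `r₀ := |jEϖ|^{2d−1}` (`2b ≥ 2d − 1 + b`) and `hrγ` (`2 + b + 2(N−1−i) ≥ 2d − 1`) — ★ F1b's and ★ A2r's
precision letters. [cite: Serre1979, Ch. IV §2 Prop. 6] [cite: Kottwitz1986BaseChangeUnits, §1 pp. 240–241] -/
theorem precisionLetters_insideCell {σ : E →+* E} {ϖ : E} {d tE : ℕ} (hD : IsRamifiedQuadraticDatum σ ϖ d tE)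
    (jE : E →+* M) (hjiso : ∀ a, Valued.v (jE a) = Valued.v a) {ρ : M →+* M} {α : M} (hU : Valued.v (α - ρ α) = 1)
    {m jl b N i : ℕ} (hb2 : 2 * b = m) (hNjl : m + 2 * N = jl) (hdb : 2 * d ≤ b) (hi : i < N)
    {ξ₀ : M} (hξv : Valued.v ξ₀ * Valued.v (jE ϖ) ^ jl = Valued.v (jE ϖ) ^ (m + 2))
    {γ₁ : E} (hγ₁v : Valued.v γ₁ = Valued.v ϖ ^ 2) :
    Valued.v ϖ ^ (b + 2 * (N - 1 - i)) * Valued.v ξ₀ * Valued.v (jE ϖ ^ (b + 2 * i) * (α - ρ α)) = Valued.v (jE ϖ) ^ (2 * b) ∧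
      Valued.v ϖ ^ (b + 2 * (N - 1 - i)) * Valued.v ξ₀ * Valued.v (jE ϖ ^ (b + 2 * i) * (α - ρ α)) < Valued.v (jE ϖ) ^ b ∧
      Valued.v ϖ ^ (b + 2 * (N - 1 - i)) * Valued.v ξ₀ * Valued.v (jE ϖ ^ (b + 2 * i) * (α - ρ α)) ≤ Valued.v (jE ϖ) ^ (2 * d - 1) * Valued.v (jE ϖ) ^ b ∧
      Valued.v γ₁ * Valued.v ϖ ^ (b + 2 * (N - 1 - i)) ≤ Valued.v ϖ ^ (2 * d - 1) := by
  obtain ⟨-, -, hϖ, -, -, hd1, -⟩ := id hD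
  have hπn : ∀ n : ℕ, Valued.v (jE ϖ) ^ n = exp (-(n : ℤ)) := fun n => by rw [hjiso, hϖ, ← exp_nsmul, nsmul_eq_mul, mul_neg, mul_one]
  have hϖn : ∀ n : ℕ, Valued.v ϖ ^ n = exp (-(n : ℤ)) := fun n => by rw [hϖ, ← exp_nsmul, nsmul_eq_mul, mul_neg, mul_one]
  -- `|ξ₀| = exp 2(N − 1)`
  have hξv' : Valued.v ξ₀ = exp (2 * ((N : ℤ) - 1)) := by
    have h1 : Valued.v ξ₀ * exp (-(jl : ℤ)) = exp (-((m + 2 : ℕ) : ℤ)) := by rw [← hπn, ← hπn]; exact hξv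
    calc Valued.v ξ₀ = Valued.v ξ₀ * exp (-(jl : ℤ)) * exp (jl : ℤ) := by rw [mul_assoc, ← exp_add, neg_add_cancel, exp_zero, mul_one]
      _ = exp (2 * ((N : ℤ) - 1)) := by rw [h1, ← exp_add]; congr 1; push_cast; omega
  have hccv : Valued.v (jE ϖ ^ (b + 2 * i) * (α - ρ α)) = Valued.v (jE ϖ) ^ (b + 2 * i) := by
    rw [Valuation.map_mul, hU, mul_one, Valuation.map_pow]
  have hprod : Valued.v ϖ ^ (b + 2 * (N - 1 - i)) * Valued.v ξ₀ * Valued.v (jE ϖ ^ (b + 2 * i) * (α - ρ α)) = Valued.v (jE ϖ) ^ (2 * b) := by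
    rw [hccv, hϖn, hξv', hπn, hπn, ← exp_add, ← exp_add]; congr 1; push_cast; omega
  refine ⟨hprod, ?_, ?_, ?_⟩
  · rw [hprod, hπn, hπn, exp_lt_exp]; omega
  · rw [hprod, ← pow_add, hπn, hπn, exp_le_exp]; omega
  · rw [hγ₁v, ← pow_add, hϖn, hϖn, exp_le_exp]; omega

/-! ## §1 ★ F1b on ONE inside cell `i < N` at its own resolution `|ϖ|^{b + 2(N−1−i)}`, every letter but frame ∕ floor ∕ row ∕ chart ∕ system discharged -/

/-- **«THE INSIDE CELL'S LAW AT ITS OWN RESOLUTION».**  General block `(H₂, h_W, φ, h, f)` in ‹CORE.letter.v1›'s frame (one-block half, binders BY NAME) + the K6 floor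
`4d ≤ N₀ ≤ m`, `|u₀₀ − 1| ≤ |ϖ|^{N₀}`, `|lam − 1| ≤ |jEϖ|^{N₀}`; the live even row `2b = m`, `d` even, window `m + 2N = jl`; the row's INSIDE CHART (★ A1 p864708's
output letters BY NAME: `hκ₀ hΘκ₀ hκ₀v hξ hΘξ hξv hμab hR₀ hγ₀ hα₁σ hα₁1 hγ₁σ hγ₁v haff`); an inside cell `i < N`; a digit system `Rd` of σ-fixed integral elements, complete and
irredundant for the fixed unit ball modulo `|ϖ|^{b + 2(N−1−i)}`.  THEN ★ F1b's K6-0 law on the cell `(b + 2i, b)` and the system `Rd` — its RAW output bytes (with the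
`.filter (fun _ => True)`). [cite: Kottwitz1986BaseChangeUnits, §1 pp. 240–241] [cite: LabesseLanglands1979, §2 (2.2) p. 9] [cite: Rogawski1990, §4.9 Prop. 4.9.1 (b) p. 55]
[cite: Serre1979, Ch. V §3 Cor. 3; Ch. XV §2] -/
theorem insideCell_law_coarse [CompleteSpace E] [IsDiscreteValuationRing 𝒪[E]] [Finite 𝓀[E]] [CompleteSpace M] [Finite 𝓀[M]]
    (σ : E →+* E) (ϖ : E) (d tE : ℕ) (hD : IsRamifiedQuadraticDatum σ ϖ d tE)
    (jE : E →+* M) (ρ Θ : M →+* M) (α lam : M)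
    (hρρ : ∀ z, ρ (ρ z) = z) (hvρ : ∀ z, Valued.v (ρ z) = Valued.v z)
    (hjv : ∀ a, Valued.v (jE a) ≤ 1 ↔ Valued.v a ≤ 1) (hjfix : ∀ z : M, ρ z = z ↔ ∃ a, jE a = z) (hΘj : ∀ a, Θ (jE a) = jE (σ a))
    (hΘΘ : ∀ z, Θ (Θ z) = z) (hΘρ : ∀ z, Θ (ρ z) = ρ (Θ z)) (hvΘ : ∀ z, Valued.v (Θ z) = Valued.v z)
    (hα : ρ α ≠ α) (hα1 : Valued.v α ≤ 1) (hint : ∀ z : M, Valued.v z ≤ 1 → Valued.v ((z - ρ z) / (α - ρ α)) ≤ 1)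
    (hΘlam : Θ lam * lam = 1) (hvlam : Valued.v lam = 1) (hU : Valued.v (α - ρ α) = 1) (hτ : Valued.v (α - Θ α) < 1)
    (hσres : ∀ z : M, ρ z = z → Valued.v z ≤ 1 → Valued.v (Θ z - z) < 1)
    (hDM : IsRamifiedQuadraticDatum Θ (jE ϖ) d tE) (hjiso : ∀ a, Valued.v (jE a) = Valued.v a)
    (hq : Nat.card 𝓀[M] = Nat.card 𝓀[E] ^ 2) (hjpow : ∀ (t : E) (n : ℤ), Valued.v (jE t) = Valued.v (jE ϖ) ^ n ↔ Valued.v t = Valued.v ϖ ^ n)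
    (hϖmax : ∀ t : M, ρ t = t → Valued.v t < 1 → Valued.v t ≤ Valued.v (jE ϖ))
    (γ₂ : GL (Fin 2) E) (u : GL (Fin 1) E) (m jl : ℕ) (hm : Valued.v (lam - jE ((u : Matrix (Fin 1) (Fin 1) E) 0 0)) = WithZero.exp (-(m : ℤ)))
    (hjl : Valued.v ((lam - jE ((u : Matrix (Fin 1) (Fin 1) E) 0 0)) - ρ (lam - jE ((u : Matrix (Fin 1) (Fin 1) E) 0 0))) = WithZero.exp (-(jl : ℤ)))
    (hum : Valued.v (((u : Matrix (Fin 1) (Fin 1) E) 0 0) - 1) ≤ Valued.v (ϖ ^ mstarOfRecord d))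
    -- the general block
    (H₂ : Matrix (Fin 2) (Fin 2) E) (hW : E) (hH₂ : IsUnit H₂.det) (hH₂σ : (H₂.map σ)ᵀ = H₂) (hhW : Valued.v hW = 1) (hhWσ : σ hW = hW)
    (P₁ : GL (Fin 3) E) (hA : formCongr σ P₁ ((StdForm.antidiagonal 3).over E) = (!![H₂ 0 0, 0, H₂ 0 1; 0, hW, 0; H₂ 1 0, 0, H₂ 1 1] : Matrix (Fin 3) (Fin 3) E))
    (hΓ : P₁ * endoGL (γ₂, u) * P₁⁻¹ ∈ unitaryGroupOfForm σ ((StdForm.antidiagonal 3).over E))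
    (φ : (Fin 2 → E) →+ M) (h : M) (hφs : ∀ (c : E) (x : Fin 2 → E), φ (c • x) = jE c * φ x) (hφi : Function.Injective φ) (hφo : Function.Surjective φ)
    (hφγ : ∀ x, φ ((γ₂ : Matrix (Fin 2) (Fin 2) E).mulVec x) = lam * φ x)
    (hform : ∀ x y, jE (pairing σ H₂ x y) = h * Θ (φ x) * φ y + ρ (h * Θ (φ x) * φ y)) (hΘh : Θ h = h) (hh : h ≠ 0)
    (f : ℕ → ℕ → AddSubgroup M → ℕ) (hfinLS : ∀ j a, (levelSet ρ Θ α (jE ϖ) h j a).Finite)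
    (hf : ∀ (b j : ℕ) (Λ : AddSubgroup M) (x₀ : M) (r : E), 1 ≤ b → x₀ ≠ 0 → (∀ x, x ∈ Λ ↔ ∃ z, IsOrd ρ α (jE ϖ ^ j) z ∧ x = x₀ * z) →
      IsOrd ρ α (jE ϖ ^ j) (dualGen ρ Θ α (jE ϖ ^ j) h x₀) → ¬ IsOrd ρ α (jE ϖ ^ j) (dualGen ρ Θ α (jE ϖ ^ j) h x₀ / jE ϖ) → Valued.v (dualGen ρ Θ α (jE ϖ ^ j) h x₀) = Valued.v (jE ϖ) ^ b →
      (∀ b', (∀ x ∈ Λ, Valued.v (h * Θ x * b' + ρ (h * Θ x * b')) ≤ 1) → (lam - jE ((u : Matrix (Fin 1) (Fin 1) E) 0 0)) * b' ∈ Λ) → IsOrd ρ α (jE ϖ ^ j) lam →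
      jE r = glueUnit ρ Θ α (jE ϖ ^ j) h (jE ϖ) (jE hW) x₀ b →
      f b j Λ = Nat.card {x : 𝒪[E] ⧸ 𝓂[E] ^ (2 * b) // ∃ u' : 𝒪[E], Ideal.Quotient.mk (𝓂[E] ^ (2 * b)) u' = x ∧ Valued.v ((u' : E) * σ u' - r) ≤ Valued.v (ϖ ^ (2 * b))})
    -- the K6 floor (‹CORE.v1›'s `_hNm _hu1N _hlam1` at the assembler's fence value `N₀`, and `4d ≤ N₀`)
    {N₀ : ℕ} (h4d : 4 * d ≤ N₀) (hN₀m : N₀ ≤ m)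
    (hu1N : Valued.v (((u : Matrix (Fin 1) (Fin 1) E) 0 0) - 1) ≤ Valued.v (ϖ ^ N₀)) (hlam1 : Valued.v (lam - 1) ≤ Valued.v (jE ϖ ^ N₀))
    -- the live even row and its window
    (b : ℕ) (hb2 : 2 * b = m) (hd0 : d % 2 = 0) {N : ℕ} (hNjl : m + 2 * N = jl)
    -- the inside chart (★ A1 p864708's letters)
    {κ₀ ξ₀ : M} (hκ₀ : κ₀ + ρ κ₀ = 1) (hΘκ₀ : Θ κ₀ = κ₀) (hκ₀v : Valued.v κ₀ = 1) (hξ : ρ ξ₀ = -ξ₀) (hΘξ : Θ ξ₀ = ξ₀)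
    (hξv : Valued.v ξ₀ * Valued.v (jE ϖ) ^ jl = Valued.v (jE ϖ) ^ (m + 2))
    {μa μb R₀ γ₀ : E} (hμab : lam - jE ((u : Matrix (Fin 1) (Fin 1) E) 0 0) = jE μa + jE μb * α)
    (hR₀ : jE R₀ = α * κ₀ + ρ (α * κ₀)) (hγ₀ : jE γ₀ = ξ₀ * (α - ρ α))
    {α₁ γ₁ : E} (hα₁σ : σ α₁ = α₁) (hα₁1 : Valued.v α₁ = 1) (hγ₁σ : σ γ₁ = γ₁) (hγ₁v : Valued.v γ₁ = Valued.v ϖ ^ 2)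
    (haff : ∀ (T W f : E), σ T = T → Valued.v T = 1 → σ W = W → Valued.v W ≤ 1 → σ f = f →
      Valued.v (T * ((μa + μb * R₀) * ((ϖ * σ ϖ) ^ b)⁻¹ + μb * γ₀ * ((ϖ * σ ϖ) ^ b)⁻¹ * W) - f * ((ϖ - σ ϖ) * ((ϖ * σ ϖ) ^ ((d - d % 2) / 2))⁻¹)) ≤
        Valued.v ϖ ^ mstarOfRecord d → normSign σ f = normSign σ T * normSign σ (α₁ + γ₁ * W))
    -- the inside cell and its digit system
    {i : ℕ} (hi : i < N)
    (Rd : Finset E) (hRd1 : ∀ V ∈ Rd, σ V = V ∧ Valued.v V ≤ 1)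
    (hRd2 : ∀ V : E, σ V = V → Valued.v V ≤ 1 → ∃ V₀ ∈ Rd, Valued.v (V - V₀) ≤ Valued.v ϖ ^ (b + 2 * (N - 1 - i)))
    (hRd3 : ∀ V ∈ Rd, ∀ V' ∈ Rd, Valued.v (V - V') ≤ Valued.v ϖ ^ (b + 2 * (N - 1 - i)) → V = V') :
    (((∑ᶠ Λ ∈ levelSetDep ρ Θ α (jE ϖ) h (b + 2 * i) b (lam - jE ((u : Matrix (Fin 1) (Fin 1) E) 0 0)) ∩
                      {Λ | ∃ B : Submodule 𝒪[E] (Fin 2 → E), B.toAddSubgroup.map φ = Λ ∧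
                        ∃ L₃ : Submodule 𝒪[E] (Fin 3 → E), IsSelfDualLattice σ ϖ (!![H₂ 0 0, 0, H₂ 0 1; 0, hW, 0; H₂ 1 0, 0, H₂ 1 1] : Matrix (Fin 3) (Fin 3) E) L₃ ∧
                          L₃ ⊓ LinearMap.ker ((LinearMap.proj (1 : Fin 3) : (Fin 3 → E) →ₗ[E] E).restrictScalars 𝒪[E]) =
                            B.map ((Matrix.toLin' (!![1, 0; 0, 0; 0, 1] : Matrix (Fin 3) (Fin 2) E)).restrictScalars 𝒪[E]) ∧
                          (∀ c : E, (Pi.single 1 c : Fin 3 → E) ∈ L₃ ↔ Valued.v c ≤ Valued.v ϖ ^ b) ∧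
                          (LatticeNearTransvShell ϖ (d % 2) (mstarOfRecord d) ((((endoGL (γ₂, u) : GL (Fin 3) E) : Matrix (Fin 3) (Fin 3) E) - 1)) L₃ ∧
                            {z : E | ∃ y ∈ L₃, Valued.v ((ϖ ^ (mstarOfRecord d))⁻¹ * (z - pairing σ (!![H₂ 0 0, 0, H₂ 0 1; 0, hW, 0; H₂ 1 0, 0, H₂ 1 1] : Matrix (Fin 3) (Fin 3) E) y (((((endoGL (γ₂, u) : GL (Fin 3) E) : Matrix (Fin 3) (Fin 3) E) - 1)) *ᵥ y))) ≤ 1} =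
                              valueSetMod σ ϖ (mstarOfRecord d) (xPlus σ ϖ d))}, f b (b + 2 * i) Λ : ℕ) : ℤ) -
                  ((∑ᶠ Λ ∈ levelSetDep ρ Θ α (jE ϖ) h (b + 2 * i) b (lam - jE ((u : Matrix (Fin 1) (Fin 1) E) 0 0)) ∩
                      {Λ | ∃ B : Submodule 𝒪[E] (Fin 2 → E), B.toAddSubgroup.map φ = Λ ∧
                        ∃ L₃ : Submodule 𝒪[E] (Fin 3 → E), IsSelfDualLattice σ ϖ (!![H₂ 0 0, 0, H₂ 0 1; 0, hW, 0; H₂ 1 0, 0, H₂ 1 1] : Matrix (Fin 3) (Fin 3) E) L₃ ∧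
                          L₃ ⊓ LinearMap.ker ((LinearMap.proj (1 : Fin 3) : (Fin 3 → E) →ₗ[E] E).restrictScalars 𝒪[E]) =
                            B.map ((Matrix.toLin' (!![1, 0; 0, 0; 0, 1] : Matrix (Fin 3) (Fin 2) E)).restrictScalars 𝒪[E]) ∧
                          (∀ c : E, (Pi.single 1 c : Fin 3 → E) ∈ L₃ ↔ Valued.v c ≤ Valued.v ϖ ^ b) ∧
                          (LatticeNearTransvShell ϖ (d % 2) (mcOfRecord d) ((((endoGL (γ₂, u) : GL (Fin 3) E) : Matrix (Fin 3) (Fin 3) E) - 1)) L₃ ∧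
                            ¬ {z : E | ∃ y ∈ L₃, Valued.v ((ϖ ^ (mstarOfRecord d))⁻¹ * (z - pairing σ (!![H₂ 0 0, 0, H₂ 0 1; 0, hW, 0; H₂ 1 0, 0, H₂ 1 1] : Matrix (Fin 3) (Fin 3) E) y (((((endoGL (γ₂, u) : GL (Fin 3) E) : Matrix (Fin 3) (Fin 3) E) - 1)) *ᵥ y))) ≤ 1} =
                              valueSetMod σ ϖ (mstarOfRecord d) (xPlus σ ϖ d))}, f b (b + 2 * i) Λ : ℕ) : ℤ)) *
        ((Rd.filter (fun V₀ : E => Valued.v (κ₀ + jE V₀ * ξ₀) * Valued.v (jE ϖ ^ (b + 2 * i) * (α - ρ α)) = Valued.v (jE ϖ) ^ b ∧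
        ∃ e : M, ρ e = e ∧ e * Θ e = (κ₀ + jE V₀ * ξ₀) * ρ (κ₀ + jE V₀ * ξ₀) / (h * ρ h))).card : ℤ) =
      ((∑ᶠ Λ ∈ levelSetDep ρ Θ α (jE ϖ) h (b + 2 * i) b (lam - jE ((u : Matrix (Fin 1) (Fin 1) E) 0 0)), f b (b + 2 * i) Λ : ℕ) : ℤ) *
        (normSign σ (-hW) * ∑ V ∈ (Rd.filter (fun V₀ : E => Valued.v (κ₀ + jE V₀ * ξ₀) * Valued.v (jE ϖ ^ (b + 2 * i) * (α - ρ α)) = Valued.v (jE ϖ) ^ b ∧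
        ∃ e : M, ρ e = e ∧ e * Θ e = (κ₀ + jE V₀ * ξ₀) * ρ (κ₀ + jE V₀ * ξ₀) / (h * ρ h))).filter (fun _ => True), normSign σ (α₁ + γ₁ * V)) := by
  classical
  obtain ⟨-, -, hϖ, -, -, hd1, -⟩ := id hD
  obtain ⟨-, hϖlt, -, -, -, -, hjϖle⟩ := uniformizer_letters jE hjv hϖ
  -- the FLOOR letters: `m⋆ = 2d − 1`, `m_c = 3d − 2 ≤ 4d ≤ N₀ ≤ m = 2b`
  have hm1 : mstarOfRecord d = 2 * d - 1 := by simp only [mstarOfRecord]; omega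
  have hmc : mcOfRecord d = 3 * d - 2 := by simp only [mcOfRecord, mstarOfRecord]; omega
  have hmcm : mcOfRecord d ≤ m := by omega
  have hdb : 2 * d ≤ b := by omega
  have hlamn : Valued.v (lam - 1) ≤ Valued.v (jE ϖ) ^ mcOfRecord d := by
    refine hlam1.trans ?_
    rw [Valuation.map_pow]
    exact pow_le_pow_right_of_le_one' hjϖle (by omega)
  have hun : Valued.v ((u : Matrix (Fin 1) (Fin 1) E) 0 0 - 1) ≤ Valued.v ϖ ^ mcOfRecord d := by
    refine hu1N.trans ?_
    rw [Valuation.map_pow]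
    exact pow_le_pow_right_of_le_one' hϖlt.le (by omega)
  -- the CLASS letters of the frame (★ p864373)
  have hFgap : ∀ z : M, ρ z = z → Θ z = z → Valued.v (jE ϖ) < Valued.v z → Valued.v z ≤ 1 → Valued.v z = 1 := fgap_of_datum hDM
  have hdeep₂ : ∀ w : M, ρ w = w → Θ w = w → Valued.v (w - 1) ≤ Valued.v (jE ϖ) ^ (2 * d) → ∃ c : M, ρ c = c ∧ c * Θ c = w :=
    deep_of_datum hD jE hjv hjfix hΘj (by omega)
  have hdeep : ∀ w : M, ρ w = w → Θ w = w → Valued.v (w - 1) ≤ Valued.v (jE ϖ) ^ (2 * d - 1) → ∃ c : M, ρ c = c ∧ c * Θ c = w :=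
    deep_of_datum hD jE hjv hjfix hΘj le_rfl
  obtain ⟨c₀, -, hc₀1, -, hdich⟩ := dich_of_datum hDM
  have hwit : ∃ a : M, Θ a = a ∧ Valued.v a = 1 ∧ ¬ ∃ e : M, ρ e = e ∧ e * Θ e = a * ρ a :=
    exists_flipWitness_of_frame hD jE hjiso hjfix hΘj hρρ hvρ hΘρ hα1 hU hDM hq hσres hτ
  -- the CHART sizes: F1b's `hξv` at `g = 1`, `|γ₁| < 1`
  have hξv₁ : Valued.v ξ₀ * Valued.v (jE ϖ) ^ jl = Valued.v (jE ϖ) ^ (2 * b + 2 * 1) := by rw [hξv]; congr 1; omega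
  have hγ₁1 : Valued.v γ₁ < 1 := by rw [hγ₁v]; exact pow_lt_one₀ zero_le hϖlt (by norm_num)
  -- the CELL letters of `(b + 2i, b)`, `i < N`
  have hbj : b ≤ b + 2 * i := by omega
  have hjm : b + 2 * i + mstarOfRecord d ≤ jl := by omega
  have hcell : b + 2 * i + b + 2 * 1 ≤ jl := by omega
  -- the PRECISION letters at `r := |ϖ|^{b + 2(N−1−i)}`, `r₀ := |jEϖ|^{2d−1}` (§0: the sharp floor is an equality)
  obtain ⟨hprod, hrR, hr₀, hrγ⟩ := precisionLetters_insideCell hD jE hjiso hU hb2 hNjl hdb hi hξv hγ₁v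
  -- ★ F1b on the cell, every letter by name
  exact rowTower_cellDiff_mul_card_eq σ ϖ d tE hD jE ρ Θ α lam hρρ hvρ hjv hjfix hΘj hΘΘ hΘρ hvΘ hα hα1 hint hvlam hU hjiso hjpow hϖmax γ₂ u m jl hm hjl hum
    H₂ hW hH₂ hH₂σ hhW hhWσ φ h hφs hφi hφo hφγ hform hΘh hh f hf hfinLS b hb2 hd0 hΘlam P₁ hA hΓ hmcm hlamn hun hFgap hdeep₂ hc₀1 hdich hwit hbj hjm
    hκ₀ hΘκ₀ hκ₀v.le hξ hΘξ (le_refl 1) hcell hξv₁ hμab hR₀ hγ₀ hα₁σ hα₁1 hγ₁σ hγ₁1 haff Rd (fun V hV => (hRd1 V hV).1) hRd2 hRd3 hprod.ge hrR hr₀ hdeep hrγ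

/-! ## §2 HEAD — every inside cell's law on ONE fine digit system `Rd⋆` -/

/-- **HEAD — «THE INSIDE CELLS' LAW ON ONE FINE DIGIT SYSTEM» (K6 DESK WORD #17 A2).**  Frame, floor, row and chart letters of §1 (the general block `(H₂, h_W, φ, h, f)` — instantiate
twice; ‹CORE.letter.v1›'s binders BY NAME; the K6 floor `4d ≤ N₀ ≤ m` with `_hu1N _hlam1` at `N₀`; the even row `2b = m`, `d % 2 = 0`, window `m + 2N = jl`; ★ A1 p864708's chart
letters BY NAME) and ONE digit system `Rd⋆` of σ-fixed integral elements, complete and irredundant for the fixed unit ball modulo `|ϖ|^{n⋆}` with `b + 2(N − 1) ≤ n⋆` (★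
`exists_repr_fixedBall_card (ρ := n⋆) (t := 0)`; the desk's `n⋆ = b + 2(N − 1)`).  THEN for every inside cell `i < N`:
`X(b+2i)·#(Rd⋆.filter LIT_i) = n(b+2i)·(normSign σ (−h_W)·Σ_{V ∈ Rd⋆.filter LIT_i} normSign σ (α₁ + γ₁·V))`, `X`, `n` the letters' finsum bytes at `j := b + 2i`, `LIT_i` ★ F1b's literal
lambda — the `hmul` letter of ★ `…CoreOfPerCellLaws.cellValue_of_perCellLaw` per inside cell, all on `Rd⋆` (§1 on the cell's own system ★ `exists_repr_fixedBall_card (ρ := b + 2(N−1−i))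
(t := 0)`, then ★ A2r `cellLaw_fine_of_coarse` at `c := h·ρh`, `C := jEϖ^{b+2i}·(α − ρα)`, `y := |jEϖ|^b`, `hPiff := Iff.rfl`).
[cite: Kottwitz1986BaseChangeUnits, §1 pp. 240–241] [cite: LabesseLanglands1979, §2 (2.2) p. 9] [cite: Rogawski1990, §4.9 Prop. 4.9.1 (b) p. 55] [cite: Serre1979, Ch. IV §2 Prop. 6; Ch. V §3 Cor. 3] -/
theorem insideCells_law_fine [CompleteSpace E] [IsDiscreteValuationRing 𝒪[E]] [Finite 𝓀[E]] [CompleteSpace M] [Finite 𝓀[M]]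
    (σ : E →+* E) (ϖ : E) (d tE : ℕ) (hD : IsRamifiedQuadraticDatum σ ϖ d tE)
    (jE : E →+* M) (ρ Θ : M →+* M) (α lam : M)
    (hρρ : ∀ z, ρ (ρ z) = z) (hvρ : ∀ z, Valued.v (ρ z) = Valued.v z)
    (hjv : ∀ a, Valued.v (jE a) ≤ 1 ↔ Valued.v a ≤ 1) (hjfix : ∀ z : M, ρ z = z ↔ ∃ a, jE a = z) (hΘj : ∀ a, Θ (jE a) = jE (σ a))
    (hΘΘ : ∀ z, Θ (Θ z) = z) (hΘρ : ∀ z, Θ (ρ z) = ρ (Θ z)) (hvΘ : ∀ z, Valued.v (Θ z) = Valued.v z)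
    (hα : ρ α ≠ α) (hα1 : Valued.v α ≤ 1) (hint : ∀ z : M, Valued.v z ≤ 1 → Valued.v ((z - ρ z) / (α - ρ α)) ≤ 1)
    (hΘlam : Θ lam * lam = 1) (hvlam : Valued.v lam = 1) (hU : Valued.v (α - ρ α) = 1) (hτ : Valued.v (α - Θ α) < 1)
    (hσres : ∀ z : M, ρ z = z → Valued.v z ≤ 1 → Valued.v (Θ z - z) < 1)
    (hDM : IsRamifiedQuadraticDatum Θ (jE ϖ) d tE) (hjiso : ∀ a, Valued.v (jE a) = Valued.v a)
    (hq : Nat.card 𝓀[M] = Nat.card 𝓀[E] ^ 2) (hjpow : ∀ (t : E) (n : ℤ), Valued.v (jE t) = Valued.v (jE ϖ) ^ n ↔ Valued.v t = Valued.v ϖ ^ n)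
    (hϖmax : ∀ t : M, ρ t = t → Valued.v t < 1 → Valued.v t ≤ Valued.v (jE ϖ))
    (γ₂ : GL (Fin 2) E) (u : GL (Fin 1) E) (m jl : ℕ) (hm : Valued.v (lam - jE ((u : Matrix (Fin 1) (Fin 1) E) 0 0)) = WithZero.exp (-(m : ℤ)))
    (hjl : Valued.v ((lam - jE ((u : Matrix (Fin 1) (Fin 1) E) 0 0)) - ρ (lam - jE ((u : Matrix (Fin 1) (Fin 1) E) 0 0))) = WithZero.exp (-(jl : ℤ)))
    (hum : Valued.v (((u : Matrix (Fin 1) (Fin 1) E) 0 0) - 1) ≤ Valued.v (ϖ ^ mstarOfRecord d))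
    -- the general block
    (H₂ : Matrix (Fin 2) (Fin 2) E) (hW : E) (hH₂ : IsUnit H₂.det) (hH₂σ : (H₂.map σ)ᵀ = H₂) (hhW : Valued.v hW = 1) (hhWσ : σ hW = hW)
    (P₁ : GL (Fin 3) E) (hA : formCongr σ P₁ ((StdForm.antidiagonal 3).over E) = (!![H₂ 0 0, 0, H₂ 0 1; 0, hW, 0; H₂ 1 0, 0, H₂ 1 1] : Matrix (Fin 3) (Fin 3) E))
    (hΓ : P₁ * endoGL (γ₂, u) * P₁⁻¹ ∈ unitaryGroupOfForm σ ((StdForm.antidiagonal 3).over E))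
    (φ : (Fin 2 → E) →+ M) (h : M) (hφs : ∀ (c : E) (x : Fin 2 → E), φ (c • x) = jE c * φ x) (hφi : Function.Injective φ) (hφo : Function.Surjective φ)
    (hφγ : ∀ x, φ ((γ₂ : Matrix (Fin 2) (Fin 2) E).mulVec x) = lam * φ x)
    (hform : ∀ x y, jE (pairing σ H₂ x y) = h * Θ (φ x) * φ y + ρ (h * Θ (φ x) * φ y)) (hΘh : Θ h = h) (hh : h ≠ 0)
    (f : ℕ → ℕ → AddSubgroup M → ℕ) (hfinLS : ∀ j a, (levelSet ρ Θ α (jE ϖ) h j a).Finite)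
    (hf : ∀ (b j : ℕ) (Λ : AddSubgroup M) (x₀ : M) (r : E), 1 ≤ b → x₀ ≠ 0 → (∀ x, x ∈ Λ ↔ ∃ z, IsOrd ρ α (jE ϖ ^ j) z ∧ x = x₀ * z) →
      IsOrd ρ α (jE ϖ ^ j) (dualGen ρ Θ α (jE ϖ ^ j) h x₀) → ¬ IsOrd ρ α (jE ϖ ^ j) (dualGen ρ Θ α (jE ϖ ^ j) h x₀ / jE ϖ) → Valued.v (dualGen ρ Θ α (jE ϖ ^ j) h x₀) = Valued.v (jE ϖ) ^ b →
      (∀ b', (∀ x ∈ Λ, Valued.v (h * Θ x * b' + ρ (h * Θ x * b')) ≤ 1) → (lam - jE ((u : Matrix (Fin 1) (Fin 1) E) 0 0)) * b' ∈ Λ) → IsOrd ρ α (jE ϖ ^ j) lam →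
      jE r = glueUnit ρ Θ α (jE ϖ ^ j) h (jE ϖ) (jE hW) x₀ b →
      f b j Λ = Nat.card {x : 𝒪[E] ⧸ 𝓂[E] ^ (2 * b) // ∃ u' : 𝒪[E], Ideal.Quotient.mk (𝓂[E] ^ (2 * b)) u' = x ∧ Valued.v ((u' : E) * σ u' - r) ≤ Valued.v (ϖ ^ (2 * b))})
    -- the K6 floor (‹CORE.v1›'s `_hNm _hu1N _hlam1` at the assembler's fence value `N₀`, and `4d ≤ N₀`)
    {N₀ : ℕ} (h4d : 4 * d ≤ N₀) (hN₀m : N₀ ≤ m)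
    (hu1N : Valued.v (((u : Matrix (Fin 1) (Fin 1) E) 0 0) - 1) ≤ Valued.v (ϖ ^ N₀)) (hlam1 : Valued.v (lam - 1) ≤ Valued.v (jE ϖ ^ N₀))
    -- the live even row and its window
    (b : ℕ) (hb2 : 2 * b = m) (hd0 : d % 2 = 0) {N : ℕ} (hNjl : m + 2 * N = jl)
    -- the inside chart (★ A1 p864708's letters)
    {κ₀ ξ₀ : M} (hκ₀ : κ₀ + ρ κ₀ = 1) (hΘκ₀ : Θ κ₀ = κ₀) (hκ₀v : Valued.v κ₀ = 1) (hξ : ρ ξ₀ = -ξ₀) (hΘξ : Θ ξ₀ = ξ₀)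
    (hξv : Valued.v ξ₀ * Valued.v (jE ϖ) ^ jl = Valued.v (jE ϖ) ^ (m + 2))
    {μa μb R₀ γ₀ : E} (hμab : lam - jE ((u : Matrix (Fin 1) (Fin 1) E) 0 0) = jE μa + jE μb * α)
    (hR₀ : jE R₀ = α * κ₀ + ρ (α * κ₀)) (hγ₀ : jE γ₀ = ξ₀ * (α - ρ α))
    {α₁ γ₁ : E} (hα₁σ : σ α₁ = α₁) (hα₁1 : Valued.v α₁ = 1) (hγ₁σ : σ γ₁ = γ₁) (hγ₁v : Valued.v γ₁ = Valued.v ϖ ^ 2)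
    (haff : ∀ (T W f : E), σ T = T → Valued.v T = 1 → σ W = W → Valued.v W ≤ 1 → σ f = f →
      Valued.v (T * ((μa + μb * R₀) * ((ϖ * σ ϖ) ^ b)⁻¹ + μb * γ₀ * ((ϖ * σ ϖ) ^ b)⁻¹ * W) - f * ((ϖ - σ ϖ) * ((ϖ * σ ϖ) ^ ((d - d % 2) / 2))⁻¹)) ≤
        Valued.v ϖ ^ mstarOfRecord d → normSign σ f = normSign σ T * normSign σ (α₁ + γ₁ * W))
    -- ONE fine digit system for the whole inside window
    (Rds : Finset E) {ns : ℕ} (hns : b + 2 * (N - 1) ≤ ns) (hRds1 : ∀ V ∈ Rds, σ V = V ∧ Valued.v V ≤ 1)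
    (hRds2 : ∀ V : E, σ V = V → Valued.v V ≤ 1 → ∃ V₀ ∈ Rds, Valued.v (V - V₀) ≤ Valued.v ϖ ^ ns)
    (hRds3 : ∀ V ∈ Rds, ∀ V' ∈ Rds, Valued.v (V - V') ≤ Valued.v ϖ ^ ns → V = V') :
    ∀ i : ℕ, i < N →
      (((∑ᶠ Λ ∈ levelSetDep ρ Θ α (jE ϖ) h (b + 2 * i) b (lam - jE ((u : Matrix (Fin 1) (Fin 1) E) 0 0)) ∩
                        {Λ | ∃ B : Submodule 𝒪[E] (Fin 2 → E), B.toAddSubgroup.map φ = Λ ∧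
                          ∃ L₃ : Submodule 𝒪[E] (Fin 3 → E), IsSelfDualLattice σ ϖ (!![H₂ 0 0, 0, H₂ 0 1; 0, hW, 0; H₂ 1 0, 0, H₂ 1 1] : Matrix (Fin 3) (Fin 3) E) L₃ ∧
                            L₃ ⊓ LinearMap.ker ((LinearMap.proj (1 : Fin 3) : (Fin 3 → E) →ₗ[E] E).restrictScalars 𝒪[E]) =
                              B.map ((Matrix.toLin' (!![1, 0; 0, 0; 0, 1] : Matrix (Fin 3) (Fin 2) E)).restrictScalars 𝒪[E]) ∧
                            (∀ c : E, (Pi.single 1 c : Fin 3 → E) ∈ L₃ ↔ Valued.v c ≤ Valued.v ϖ ^ b) ∧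
                            (LatticeNearTransvShell ϖ (d % 2) (mstarOfRecord d) ((((endoGL (γ₂, u) : GL (Fin 3) E) : Matrix (Fin 3) (Fin 3) E) - 1)) L₃ ∧
                              {z : E | ∃ y ∈ L₃, Valued.v ((ϖ ^ (mstarOfRecord d))⁻¹ * (z - pairing σ (!![H₂ 0 0, 0, H₂ 0 1; 0, hW, 0; H₂ 1 0, 0, H₂ 1 1] : Matrix (Fin 3) (Fin 3) E) y (((((endoGL (γ₂, u) : GL (Fin 3) E) : Matrix (Fin 3) (Fin 3) E) - 1)) *ᵥ y))) ≤ 1} =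
                                valueSetMod σ ϖ (mstarOfRecord d) (xPlus σ ϖ d))}, f b (b + 2 * i) Λ : ℕ) : ℤ) -
                    ((∑ᶠ Λ ∈ levelSetDep ρ Θ α (jE ϖ) h (b + 2 * i) b (lam - jE ((u : Matrix (Fin 1) (Fin 1) E) 0 0)) ∩
                        {Λ | ∃ B : Submodule 𝒪[E] (Fin 2 → E), B.toAddSubgroup.map φ = Λ ∧
                          ∃ L₃ : Submodule 𝒪[E] (Fin 3 → E), IsSelfDualLattice σ ϖ (!![H₂ 0 0, 0, H₂ 0 1; 0, hW, 0; H₂ 1 0, 0, H₂ 1 1] : Matrix (Fin 3) (Fin 3) E) L₃ ∧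
                            L₃ ⊓ LinearMap.ker ((LinearMap.proj (1 : Fin 3) : (Fin 3 → E) →ₗ[E] E).restrictScalars 𝒪[E]) =
                              B.map ((Matrix.toLin' (!![1, 0; 0, 0; 0, 1] : Matrix (Fin 3) (Fin 2) E)).restrictScalars 𝒪[E]) ∧
                            (∀ c : E, (Pi.single 1 c : Fin 3 → E) ∈ L₃ ↔ Valued.v c ≤ Valued.v ϖ ^ b) ∧
                            (LatticeNearTransvShell ϖ (d % 2) (mcOfRecord d) ((((endoGL (γ₂, u) : GL (Fin 3) E) : Matrix (Fin 3) (Fin 3) E) - 1)) L₃ ∧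
                              ¬ {z : E | ∃ y ∈ L₃, Valued.v ((ϖ ^ (mstarOfRecord d))⁻¹ * (z - pairing σ (!![H₂ 0 0, 0, H₂ 0 1; 0, hW, 0; H₂ 1 0, 0, H₂ 1 1] : Matrix (Fin 3) (Fin 3) E) y (((((endoGL (γ₂, u) : GL (Fin 3) E) : Matrix (Fin 3) (Fin 3) E) - 1)) *ᵥ y))) ≤ 1} =
                                valueSetMod σ ϖ (mstarOfRecord d) (xPlus σ ϖ d))}, f b (b + 2 * i) Λ : ℕ) : ℤ)) *
          ((Rds.filter (fun V₀ : E => Valued.v (κ₀ + jE V₀ * ξ₀) * Valued.v (jE ϖ ^ (b + 2 * i) * (α - ρ α)) = Valued.v (jE ϖ) ^ b ∧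
          ∃ e : M, ρ e = e ∧ e * Θ e = (κ₀ + jE V₀ * ξ₀) * ρ (κ₀ + jE V₀ * ξ₀) / (h * ρ h))).card : ℤ) =
        ((∑ᶠ Λ ∈ levelSetDep ρ Θ α (jE ϖ) h (b + 2 * i) b (lam - jE ((u : Matrix (Fin 1) (Fin 1) E) 0 0)), f b (b + 2 * i) Λ : ℕ) : ℤ) *
          (normSign σ (-hW) * ∑ V ∈ Rds.filter (fun V₀ : E => Valued.v (κ₀ + jE V₀ * ξ₀) * Valued.v (jE ϖ ^ (b + 2 * i) * (α - ρ α)) = Valued.v (jE ϖ) ^ b ∧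
          ∃ e : M, ρ e = e ∧ e * Θ e = (κ₀ + jE V₀ * ξ₀) * ρ (κ₀ + jE V₀ * ξ₀) / (h * ρ h)), normSign σ (α₁ + γ₁ * V)) := by
  intro i hi
  classical
  obtain ⟨hσσ, hvσ, hϖ, hfix, hdiff, -, -⟩ := id hD
  obtain ⟨-, hϖlt, -, hvjϖ0, -, -, -⟩ := uniformizer_letters jE hjv hϖ
  -- the cell's own digit system modulo `|ϖ|^{b + 2(N−1−i)}` (★ `exists_repr_fixedBall_card (t := 0)`)
  obtain ⟨Rd, hRd1', hRd2', hRd3', -⟩ := exists_repr_fixedBall_card hσσ hvσ hfix hϖ hdiff (b + 2 * (N - 1 - i)) 0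
  have h10 : Valued.v ϖ ^ (2 * 0) = 1 := by rw [mul_zero, pow_zero]
  have hρ0 : b + 2 * (N - 1 - i) + 2 * 0 = b + 2 * (N - 1 - i) := by rw [mul_zero, add_zero]
  have hRd1 : ∀ V ∈ Rd, σ V = V ∧ Valued.v V ≤ 1 := fun V hV => ⟨(hRd1' V hV).1, h10 ▸ (hRd1' V hV).2⟩
  have hRd2 : ∀ V : E, σ V = V → Valued.v V ≤ 1 → ∃ V₀ ∈ Rd, Valued.v (V - V₀) ≤ Valued.v ϖ ^ (b + 2 * (N - 1 - i)) := fun V hσV hV1 => by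
    obtain ⟨V₀, hV₀, hVV₀⟩ := hRd2' V hσV (h10.symm ▸ hV1)
    exact ⟨V₀, hV₀, hρ0 ▸ hVV₀⟩
  have hRd3 : ∀ V ∈ Rd, ∀ V' ∈ Rd, Valued.v (V - V') ≤ Valued.v ϖ ^ (b + 2 * (N - 1 - i)) → V = V' :=
    fun V hV V' hV' hVV' => hRd3' V hV V' hV' (hρ0.symm ▸ hVV')
  -- §1: ★ F1b on the cell and its own system
  have hlaw := insideCell_law_coarse σ ϖ d tE hD jE ρ Θ α lam hρρ hvρ hjv hjfix hΘj hΘΘ hΘρ hvΘ hα hα1 hint hΘlam hvlam hU hτ hσres hDM hjiso hq hjpow hϖmax γ₂ u m jl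
    hm hjl hum H₂ hW hH₂ hH₂σ hhW hhWσ P₁ hA hΓ φ h hφs hφi hφo hφγ hform hΘh hh f hfinLS hf h4d hN₀m hu1N hlam1 b hb2 hd0 hNjl hκ₀ hΘκ₀ hκ₀v hξ hΘξ hξv hμab hR₀ hγ₀
    hα₁σ hα₁1 hγ₁σ hγ₁v haff hi Rd hRd1 hRd2 hRd3
  -- ★ A2r: the literal predicate and the label are class functions modulo the cell's resolution
  have hdb : 2 * d ≤ b := by omega
  obtain ⟨-, hrR, hr₀, hrγ⟩ := precisionLetters_insideCell hD jE hjiso hU hb2 hNjl hdb hi hξv hγ₁v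
  have hC : Valued.v (jE ϖ ^ (b + 2 * i) * (α - ρ α)) ≠ 0 := by
    rw [Valuation.map_mul, hU, mul_one, Valuation.map_pow]; exact pow_ne_zero _ hvjϖ0
  have hγ₁1 : Valued.v γ₁ < 1 := by rw [hγ₁v]; exact pow_lt_one₀ zero_le hϖlt (by norm_num)
  exact cellLaw_fine_of_coarse hD jE hjfix hΘj hjiso hρρ hvρ hΘρ hκ₀ hΘκ₀ hκ₀v hξ hΘξ (h * ρ h) (jE ϖ ^ (b + 2 * i) * (α - ρ α)) (Valued.v (jE ϖ) ^ b) hC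
    hα₁σ hα₁1 hγ₁σ hγ₁1 _ (fun _ _ _ => Iff.rfl) Rd Rds (by omega) hRd1 hRd2 hRd3 hRds1 hRds2 hRds3 hrR hr₀ hrγ _ _ _ hlaw

end Summit.HodgeConjecture.HodgeConjecture.Cruxes.H413.F0P3cDyRamInsideCellsLawFine

end
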